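import Summits.BirchSwinnertonDyer.BirchSwinnertonDyer.Theses.SignedBaseChange
import Summits.BirchSwinnertonDyer.BirchSwinnertonDyer.Theorems.SignedBaseChangeAnticyclotomicEisensteinDivisibilityOfFiniteExponentTateTC
import Summits.BirchSwinnertonDyer.BirchSwinnertonDyer.Theorems.SignedBaseChangeAnticyclotomicEisensteinDivisibilityBdpLowerHalfAllAdditive
import Summits.BirchSwinnertonDyer.BirchSwinnertonDyer.Theorems.SignedBaseChangeAnticyclotomicEisensteinDivisibilityOrdinary
import Summits.BirchSwinnertonDyer.BirchSwinnertonDyer.Theorems.SignedBaseChangeAnticyclotomicEisensteinDivisibilityXAcTorsionOfLongoVigni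
import Summits.BirchSwinnertonDyer.BirchSwinnertonDyer.Theorems.SignedBaseChangeAnticyclotomicEisensteinDivisibilityMinusIsBDPSupersingularBCS
import Literature.NumberTheory.EllipticCurves.CastellaHsuKunduLeeLiu2025.HeegnerPointMainConjectureSupersingularBDP
import Literature.NumberTheory.IwasawaTheory.Greenberg2006.GlobalEulerPoincareCorankOfTateTC
import Literature.NumberTheory.GaloisCohomology.RestrictedRamificationPoitouTateThreeLeTotallyComplex
import Summits.BirchSwinnertonDyer.BirchSwinnertonDyer.Theorems.SignedBaseChangeAnticyclotomicEisensteinDivisibilityBdpLowerHalfSemistable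
import Literature.NumberTheory.DiophantineGeometry.ConductorAdditiveProofs
import Literature.NumberTheory.EllipticCurves.RootNumberTwistProofs
import Literature.NumberTheory.EllipticCurves.AdditiveReductionRamifiedTorsionProofs
import Literature.NumberTheory.EllipticCurves.NeronOggShafarevichLocal
import HarnessLib

/-! # Line `admdef` v2 — Theorems home of its two kernel lemmas: the α-lemma (`q² ∣ N_E` ⟹ `E[p]` ramified at `q`) and
# "C⁺⁺_NS ⟹ S1 on the non-square-free all-ramified cell at `p ∤ h_K`"

Crux `AnticyclotomicEisensteinDivisibility` (stmt-BirchSwinnertonDyer-20727, route `SignedBaseChange`), line `admdef`, skeleton v2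
cee32bd27dbcd0ea (LEAD bsd-line-sbc-p1 gen 15). The two PROVED lemmas of the skeleton that are not plumbing, moved out of the Cruxes
workfile into a Theorems module (verbatim; the α-lemma is the ideator bsd-idea-5's proof) so that the kernel census
`…OfStubsAdmdefV2` and future lines can import them:
* `exists_inertia_smul_geomTorsion_ne_of_sq_dvd_conductorNorm` / `allRamified_of_allAdditive` — `q² ∣ N_E`, `p ≥ 3` good ⟹ an inertia
  element above `q` moves a point of `E[p]` (additive Néron–Ogg–Shafarevich, AEC VII.7.1, globalised with inertia membership kept);
* `bdpLowerHalfRatSS_ramifiedNS_of_chkllPlusRatNS` — the registered S1 text with binders `¬ p ∣ h_K`, `¬ Squarefree N`, all-ramified, from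
  the research statement C⁺⁺_NS (hypothesis `hC` = the body of `AdmdefLine.CHKLLPlusRatNS`), via frame concordance p634869.
All PROVED; `hC` is a hypothesis (audit `proof.conditional` where it enters). BSD / the crux / C⁺⁺_NS are NOT proved by this file
(`--supports stmt-BirchSwinnertonDyer-20727`).
-/

-- D-0017: single-problem summit, the namespace repeats the problem name by design.
set_option linter.dupNamespace false
set_option autoImplicit false

noncomputable section

open scoped Classical NumberField

open NumberField IsDedekindDomain Field
  Literature.NumberTheory.EllipticCurves Literature.NumberTheory.EllipticCurves.ModularForms
  Literature.NumberTheory.EllipticCurves.Rank1Residual Literature.NumberTheory.EllipticCurves.Castella2018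
  Literature.NumberTheory.EllipticCurves.CastellaWan2024 Literature.NumberTheory.GaloisRepresentations
  Literature.NumberTheory.EllipticCurves.YanZhu2026
  Summit.BirchSwinnertonDyer.Rank1Residual.X11b Summit.BirchSwinnertonDyer.Rank1Residual.X11b.Halves
  Summit.BirchSwinnertonDyer.BirchSwinnertonDyer.Theorems

namespace Summit.BirchSwinnertonDyer.BirchSwinnertonDyer.Theorems.SignedBaseChangeAcDivAdmdefRamifiedNS

open Summit.BirchSwinnertonDyer.BirchSwinnertonDyer.Theses.SignedBaseChange

/-! ## Cell α lies INSIDE the all-ramified cell (PROVED): `q² ∣ N_E`, `p ≥ 3` good ⟹ `E[p]` ramified at `q` -/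

/-- Plumbing [folklore]: a natural number `n` lies in the finite place `v` of `ℚ` iff the prime under `v` divides `n`
(Mathlib's `Rat.HeightOneSpectrum.natGenerator_dvd_iff` pulled back along `Rat.IsIntegralClosure.intEquiv`). -/
theorem natCast_mem_asIdeal_iff_natGenerator_dvd (v : HeightOneSpectrum (𝓞 ℚ)) (n : ℕ) :
    ((n : ℕ) : 𝓞 ℚ) ∈ v.asIdeal ↔ Rat.HeightOneSpectrum.natGenerator v ∣ n := by
  rw [Rat.HeightOneSpectrum.natGenerator_dvd_iff, ← map_natCast (Rat.IsIntegralClosure.intEquiv (𝓞 ℚ)) n,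
    Ideal.apply_mem_of_equiv_iff]

/-- **`q² ∣ N_E` and `p ≥ 3` of good reduction ⟹ an inertia element at a prime of `ℚ̄` over `q` moves a geometric
`p`-torsion point of `E` (PROVED).**  `q² ∣ N_E` ⟹ `f_q ≥ 2` (`factorization_conductorNorm_holds`) ⟹ additive reduction
at the place of `q` (`two_le_conductorExponent_iff_holds`, Silverman ATAEC IV.10.2(c)), transported from `ℤ` to `𝓞 ℚ`
(`hasAdditiveReductionAt_int_iff_ringOfIntegers`); `q ≠ p` because `p ∤ N_E` (`not_dvd_conductorNorm_of_hasGoodReductionAtPrime`);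
then the ADDITIVE case of Néron–Ogg–Shafarevich on `E[p]`, `p ≥ 3` (`exists_inertia_smul_ne_of_hasAdditiveReductionAt`,
AEC VII.6.1 / VII.7.1: `#E(K_q^nr)[p] ≤ [E : E₀] ≤ 4 < p²`) globalised along `ℚ̄ ↪ \bar ℚ_q` exactly as in the tree's
`exists_smul_geomTorsion_ne_of_hasAdditiveReductionAt`, but KEEPING the inertia membership
(`resGalOfEmb_mem_inertia_primeBelow`, `primeBelow_mem_primesAbove`).  CONSEQUENCE for the cut: bsd-idea-14's cell α
(every bad prime additive, `PrimkolyCells.CellAlpha`) is contained in binder (ii) of C⁺⁺ — C⁺⁺ is a SECOND road on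
cell α, independent of the BLV∘CW conjunct of `stub_namedFactsSS` (reading flag `BLV-step4-UNSOURCED-on-R4`).
[cite: SilvermanAEC2009, Thm. VII.7.1 (PDF p. 179)] [cite: Silverman1994, IV.10.2(c)] -/
theorem exists_inertia_smul_geomTorsion_ne_of_sq_dvd_conductorNorm (W : WeierstrassCurve ℚ) [W.IsElliptic]
    {p : ℕ} [Fact p.Prime] (hp3 : 3 ≤ p) (hgood : W.HasGoodReductionAtPrime p) {q : ℕ} (hq : q.Prime)
    (hsq : q ^ 2 ∣ W.conductorNorm ℤ) :
    ∃ v' : IsDedekindDomain.HeightOneSpectrum (NumberField.RingOfIntegers ℚ),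
      ((q : ℕ) : NumberField.RingOfIntegers ℚ) ∈ v'.asIdeal ∧ ∃ 𝔓 ∈ v'.primesAbove,
        ∃ σ ∈ 𝔓.inertia (Field.absoluteGaloisGroup ℚ), ∃ P : W.geomTorsion (p : ℤ), σ • P ≠ P := by
  have hp : p.Prime := Fact.out
  -- the places of `ℤ` and of `𝓞 ℚ` at `q`
  set vZ : HeightOneSpectrum ℤ := (Rat.HeightOneSpectrum.primesEquiv (R := ℤ)).symm ⟨q, hq⟩ with hvZ
  set v' : HeightOneSpectrum (𝓞 ℚ) := (Rat.HeightOneSpectrum.primesEquiv (R := 𝓞 ℚ)).symm ⟨q, hq⟩ with hv'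
  have hgen : Rat.HeightOneSpectrum.natGenerator vZ = q :=
    congrArg Subtype.val ((Rat.HeightOneSpectrum.primesEquiv (R := ℤ)).apply_symm_apply ⟨q, hq⟩)
  -- `f_q ≥ 2`, i.e. additive reduction at `q`
  have h2 : 2 ≤ W.conductorExponent vZ := by
    rw [← W.factorization_conductorNorm_holds vZ, hgen]
    exact (hq.pow_dvd_iff_le_factorization (W.conductorNorm_pos_holds).ne').mp hsq
  have hadd : W.HasAdditiveReductionAt v' :=
    (W.hasAdditiveReductionAt_int_iff_ringOfIntegers ⟨q, hq⟩).mp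
      ((WeierstrassCurve.two_le_conductorExponent_iff_holds vZ W).mp h2)
  -- `q ∈ v'`, and `p ∉ v'` (`p ≠ q` since `p ∤ N_E`)
  have hgen' : Rat.HeightOneSpectrum.natGenerator v' = q :=
    congrArg Subtype.val ((Rat.HeightOneSpectrum.primesEquiv (R := 𝓞 ℚ)).apply_symm_apply ⟨q, hq⟩)
  have hqmem : ((q : ℕ) : 𝓞 ℚ) ∈ v'.asIdeal := by
    rw [natCast_mem_asIdeal_iff_natGenerator_dvd, hgen']
  have hpv : ((p : ℕ) : 𝓞 ℚ) ∉ v'.asIdeal := by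
    intro hpmem
    have h1 := (natCast_mem_asIdeal_iff_natGenerator_dvd v' p).mp hpmem
    rw [hgen'] at h1
    have hpq : p = q := ((Nat.prime_dvd_prime_iff_eq hq hp).mp h1).symm
    have hpN : ¬ p ∣ W.conductorNorm ℤ := not_dvd_conductorNorm_of_hasGoodReductionAtPrime W hgood
    rw [hpq] at hpN
    exact hpN ((dvd_pow_self q two_ne_zero).trans hsq)
  -- a local inertia element at `q` moving a `p`-torsion point (additive Néron–Ogg–Shafarevich), globalised
  obtain ⟨w, hw⟩ := v'.exists_spectralValuation
  obtain ⟨𝔐, h𝔐⟩ := v'.localPrimesAbove_nonempty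
  obtain ⟨τ, hτ, Q, hpQ, hτQ⟩ := W.exists_inertia_smul_ne_of_hasAdditiveReductionAt hadd hp hp3 hpv hw h𝔐
  obtain ⟨P₀, hpP₀, hP₀Q⟩ := exists_pointsMapOfEmb_eq_of_nsmul_eq_zero W
    (closureEmb (K := ℚ) (v'.adicCompletion ℚ)) hp.ne_zero hpQ
  have hmem : P₀ ∈ W.geomTorsion (p : ℤ) :=
    (Submodule.mem_torsionBy_iff _ _).mpr (show (p : ℤ) • P₀ = 0 by rw [natCast_zsmul, hpP₀])
  have hσI : Literature.NumberTheory.EllipticCurves.resGal (K := ℚ) (v'.adicCompletion ℚ) τ ∈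
      (v'.primeBelow (closureEmb (K := ℚ) (v'.adicCompletion ℚ)) 𝔐).inertia (absoluteGaloisGroup ℚ) := by
    rw [Literature.NumberTheory.EllipticCurves.resGal_eq]
    exact HeightOneSpectrum.resGalOfEmb_mem_inertia_primeBelow v' _ 𝔐 hτ
  refine ⟨v', hqmem, v'.primeBelow (closureEmb (K := ℚ) (v'.adicCompletion ℚ)) 𝔐,
    HeightOneSpectrum.primeBelow_mem_primesAbove h𝔐,
    Literature.NumberTheory.EllipticCurves.resGal (K := ℚ) (v'.adicCompletion ℚ) τ, hσI, ⟨P₀, hmem⟩,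
    fun h ↦ hτQ ?_⟩
  have h' := congrArg
    (fun R : W.geomTorsion (p : ℤ) ↦ pointsMap W (v'.adicCompletion ℚ) (R : WeierstrassCurve.geomPoints W)) h
  simp only [Literature.NumberTheory.EllipticCurves.AddSubgroup.torsionBy.coe_smul, pointsMap_smul] at h'
  rw [← hP₀Q]
  exact h'

/-- **Binder form (PROVED): on the route's binders, ALL-ADDITIVE (`ℓ ∣ N ⟹ ℓ² ∣ N`, bsd-idea-14's cell α) ⟹
ALL-RAMIFIED (binder (ii) of C⁺⁺)** — so the hypothesis `¬ all-additive` of the residue stub γ′ is REDUNDANT given its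
`¬ all-ramified`, and C⁺⁺ covers cell α as well as cell β. -/
theorem allRamified_of_allAdditive (W : WeierstrassCurve ℚ) [W.IsElliptic] {p : ℕ} [Fact p.Prime] (hp : 5 ≤ p)
    (hgood : W.HasGoodReductionAtPrime p) {N : ℕ} (hN : (N : ℤ) = W.conductorNorm ℤ)
    (hsq : ∀ ℓ : ℕ, ℓ.Prime → ℓ ∣ N → ℓ ^ 2 ∣ N) :
    ∀ q : ℕ, q.Prime → q ∣ N → ∃ v' : IsDedekindDomain.HeightOneSpectrum (NumberField.RingOfIntegers ℚ), ((q : ℕ) : NumberField.RingOfIntegers ℚ) ∈ v'.asIdeal ∧ ∃ 𝔓 ∈ v'.primesAbove, ∃ σ ∈ 𝔓.inertia (Field.absoluteGaloisGroup ℚ), ∃ P : W.geomTorsion (p : ℤ), σ • P ≠ P := by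
  intro q hq hqN
  have hN' : (W.conductorNorm ℤ : ℕ) = N := by exact_mod_cast hN.symm
  have hsq' : q ^ 2 ∣ W.conductorNorm ℤ := by
    rw [hN']
    exact hsq q hq hqN
  exact exists_inertia_smul_geomTorsion_ne_of_sq_dvd_conductorNorm W (by omega) hgood hq hsq'

/-! ## Kernel (PROVED): C⁺⁺ closes the all-ramified cell; the LEAD's research stub follows from the two new stubs -/

/-- **C⁺⁺_NS ⟹ S1 on the NON-SQUARE-FREE ALL-RAMIFIED cell at `p ∤ h_K` (PROVED).**  The registered S1 text with the three
binders `¬ p ∣ NumberField.classNumber K →`, `¬ Squarefree N →` and "every `q ∣ N` has an inertia element moving a `p`-torsion point"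
inserted after `κ₂.IsAnticyclotomic →` — i.e. the type of the width seat's `SignedBaseChangeAcDivBdpLowerHalfSemistable.bdpLowerHalfRatSS_semistable_of_CHKLL`
with `Squarefree N →` replaced by `¬ Squarefree N →` — from C⁺⁺_NS.  Proof: w7's proof VERBATIM, the new binder passed INTO the stub and
used nowhere else; frame concordance p634869, `J/J₀` rigidity, push along `R₀ → 𝒪_{ℂ_p}` unchanged (v1's `…_ramified_of_chkllPlusRat`,
ideator bsd-idea-5, with one binder threaded). [cite: CastellaEtAl2025, Thm. 7.1 / Cor. 7.2] [cite: Castella2018, Thm. 3.1] -/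
theorem bdpLowerHalfRatSS_ramifiedNS_of_chkllPlusRatNS (hC : (∀ {p : ℕ} [Fact p.Prime] (ι : PadicAlgCl p ≃+* ℂ) (W : WeierstrassCurve ℚ) [W.IsElliptic]
    [W.IsGloballyMinimal] (K : Type) [Field K] [NumberField K]
    (𝔭 𝔭bar : HeightOneSpectrum (𝓞 K)) (κ : ZpExtension K p) (γ : absoluteGaloisGroup K)
    [Fact (κ.IsTopGenerator γ)] {N : ℕ} [NeZero N] {f : CuspForm (CongruenceSubgroup.Gamma0 N) 2}
    (_ : IsNewformOf W f),
    (N : ℤ) = W.conductorNorm ℤ → 5 ≤ p → W.HasGoodReductionAtPrime p → W.frobeniusTrace p = 0 →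
    Surj W p →
    IsImaginaryQuadratic K → ((Ideal.span {(p : ℤ)}).primesOver (𝓞 K)).ncard = 2 →
      ((p : ℕ) : 𝓞 K) ∈ 𝔭.asIdeal →
      (∀ (w : InfinitePlace K) (k : 𝓞 K), k ∈ 𝔭.asIdeal ↔ ‖ι.symm (w.embedding (k : K))‖ < 1) →
      ((p : ℕ) : 𝓞 K) ∈ 𝔭bar.asIdeal → 𝔭bar ≠ 𝔭 →
    (∀ ℓ : ℕ, ℓ.Prime → ℓ ∣ N → ((Ideal.span {(ℓ : ℤ)}).primesOver (𝓞 K)).ncard = 2) →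
    IsCoprime (N : ℤ) (NumberField.discr K) → ¬ p ∣ NumberField.classNumber K →
    -- (i) NEGATED: `N` is NOT square-free (the square-free case is the printed theorem, conjunct 8 of the cite stub)
    ¬ Squarefree N →
    -- (ii): `E[p]` ramified at every prime `q ∣ N`
    (∀ q : ℕ, q.Prime → q ∣ N →
      ∃ v : HeightOneSpectrum (𝓞 ℚ), ((q : ℕ) : 𝓞 ℚ) ∈ v.asIdeal ∧
        ∃ 𝔓 ∈ v.primesAbove, ∃ σ ∈ 𝔓.inertia (absoluteGaloisGroup ℚ),
          ∃ P : W.geomTorsion (p : ℤ), σ • P ≠ P) →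
    κ.IsAnticyclotomic →
    ∃ (ΩK : ℂ) (Ωp : (unrIntegers p)ˣ) (L : UnrSeries p),
      ΩK ≠ 0 ∧
      IsCWBDPLFunction ι 𝔭 κ γ f (NumberField.discr K) ΩK ((Ωp : unrIntegers p) : ℂ_[p]) L ∧
      ∀ (j : ℤ_[p] →+* unrIntegers p),
        (∀ x : ℤ_[p], ((j x : unrIntegers p) : ℂ_[p]) = algebraMap ℚ_[p] ℂ_[p] (x : ℚ_[p])) →
        ∃ k : ℕ,
          Ideal.span {PowerSeries.C ((p : unrIntegers p) ^ k)} *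
              (Castella2018.AcSelmer.XAc.charIdeal (W.baseChange K) p κ 𝔭bar ∅ γ).map (PowerSeries.map j) ≤
            Ideal.span {L})) :
    SignedTwoVariableInputs → Literature.NumberTheory.EllipticCurves.ModularForms.nonempty_modularParametrizationData → ∀ (W : WeierstrassCurve ℚ) [W.IsElliptic] [W.IsGloballyMinimal] (p : ℕ) [Fact p.Prime], 5 ≤ p → W.HasGoodReductionAtPrime p → W.frobeniusTrace p = 0 → Literature.NumberTheory.EllipticCurves.Rank1Residual.Surj W p → ∀ (K : Type) [Field K] [NumberField K] (ι : PadicAlgCl p ≃+* ℂ) (v vbar : IsDedekindDomain.HeightOneSpectrum (NumberField.RingOfIntegers K)) (κ₁ κ₂ : Literature.NumberTheory.EllipticCurves.ZpExtension K p) (γ₁ γ₂ : Field.absoluteGaloisGroup K) [Fact (Literature.NumberTheory.EllipticCurves.ZpExtension.IsTopGeneratorPair κ₁ κ₂ γ₁ γ₂)] [NeZero (NumberField.discr K).natAbs] (N : ℕ) [NeZero N] (f : CuspForm (CongruenceSubgroup.Gamma0 N) 2), Literature.NumberTheory.EllipticCurves.ModularForms.IsNewformOf W f → (N : ℤ) =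 W.conductorNorm ℤ → Literature.NumberTheory.EllipticCurves.IsImaginaryQuadratic K → ((Ideal.span {(p : ℤ)}).primesOver (NumberField.RingOfIntegers K)).ncard = 2 → ((p : ℕ) : NumberField.RingOfIntegers K) ∈ v.asIdeal → ((p : ℕ) : NumberField.RingOfIntegers K) ∈ vbar.asIdeal → vbar ≠ v → (∀ (w : NumberField.InfinitePlace K) (k : NumberField.RingOfIntegers K), k ∈ v.asIdeal ↔ ‖ι.symm (w.embedding (k : K))‖ < 1) → IsCoprime (N : ℤ) (NumberField.discr K) → (∀ ℓ : ℕ, ℓ.Prime → ℓ ∣ N → ((Ideal.span {(ℓ : ℤ)}).primesOver (NumberField.RingOfIntegers K)).ncard = 2) → Odd (NumberField.discr K) → NumberField.discr K ≠ -3 → κ₁.IsCyclotomic → κ₂.IsAnticyclotomic → ¬ p ∣ NumberField.classNumber K → ¬ Squarefree N → (∀ q : ℕ, q.Prime → q ∣ N → ∃ v' : IsDedekindDomain.HeightOneSpectrum (NumberField.RingOfIntegers ℚ), ((q : ℕ) : NumberField.RingOfIntegers ℚ) ∈ v'.asIdeal ∧ ∃ 𝔓 ∈ v'.primesAbove, ∃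 σ ∈ 𝔓.inertia (Field.absoluteGaloisGroup ℚ), ∃ P : W.geomTorsion (p : ℤ), σ • P ≠ P) → (haveI : Fact (κ₂.IsTopGenerator γ₂) := ⟨Literature.NumberTheory.EllipticCurves.YanZhu2026.isTopGenerator_of_pair (κ₁ := κ₁) (γ₁ := γ₁)⟩; Module.IsTorsion (Literature.NumberTheory.EllipticCurves.IwasawaAlgebra p) (Literature.NumberTheory.EllipticCurves.Castella2018.AcSelmer.XAc (W.baseChange K) p κ₂ vbar ∅ γ₂)) → ∀ (ΩK : ℂ) (Ωp' : (Literature.NumberTheory.EllipticCurves.unrIntegers p)ˣ) (L : Literature.NumberTheory.EllipticCurves.UnrSeries p), ΩK ≠ 0 → Literature.NumberTheory.EllipticCurves.IsBDPLFunction ι v κ₂ γ₂ f ΩK ((Ωp' : Literature.NumberTheory.EllipticCurves.unrIntegers p) : PadicComplex p) L → ∀ J : ℤ_[p] →+* PadicComplexInt p, (∀ x : ℤ_[p], ((J x : PadicComplexInt p) : PadicComplex p) = ((x : ℚ_[p]) : PadicComplex p)) → ∀ (J₀ : Literature.NumberTheory.EllipticCurves.unrIntegers p →+* PadicComplexInt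 p), (∀ x : Literature.NumberTheory.EllipticCurves.unrIntegers p, ((J₀ x : PadicComplexInt p) : PadicComplex p) = (x : PadicComplex p)) → ∃ k : ℕ, ∀ y ∈ (haveI : Fact (κ₂.IsTopGenerator γ₂) := ⟨Literature.NumberTheory.EllipticCurves.YanZhu2026.isTopGenerator_of_pair (κ₁ := κ₁) (γ₁ := γ₁)⟩; Literature.NumberTheory.EllipticCurves.Castella2018.AcSelmer.XAc.charIdeal (W.baseChange K) p κ₂ vbar ∅ γ₂).map (PowerSeries.map J), PowerSeries.C (((p : ℕ) : PadicComplexInt p) ^ k) * y ∈ Ideal.span {PowerSeries.map J₀ L} := by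
  intro hIn hmodP W _ _ p _ hp hgood ha0 hs K _ _ ι v vbar κ₁ κ₂ γ₁ γ₂ _ _ N _ f hf hN hK hsplit hv hvbar hvv hι hcop hHeeg hodd
    hne3 hκ₁ hκ₂ hh hnsq hram htors ΩK Ωp' L hΩK hL J hJ J₀ hJ₀
  haveI hγF : Fact (κ₂.IsTopGenerator γ₂) := ⟨isTopGenerator_of_pair (κ₁ := κ₁) (γ₁ := γ₁)⟩
  have hprime : p.Prime := Fact.out
  have hp2 : p ≠ 2 := by omega
  -- the research stub at `(ι, W, K, v, v̄, κ₂, γ₂, f)`: a Castella–Wan frame and the rational inclusion along `toUnr`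
  obtain ⟨ΩKw, Ωpw, LW, hΩKw, hLW, hk⟩ :=
    hC ι W K v vbar κ₂ γ₂ hf hN hp hgood ha0 hs hK hsplit hv hι hvbar hvv hHeeg hcop hh hnsq hram hκ₂
  obtain ⟨k, hkle⟩ := hk (toUnr p) (coe_toUnr p)
  -- the structure maps of S1 are the canonical ones (`𝒪_{ℂ_p} ↪ ℂ_p` is injective)
  have hJ₀eq : J₀ = R1.unrToCpInt p :=
    RingHom.ext fun x ↦ Subtype.ext ((hJ₀ x).trans (R1.coe_unrToCpInt p x).symm)
  subst hJ₀eq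
  have hJeq : J = R1.toCpInt p :=
    RingHom.ext fun x ↦ Subtype.ext ((hJ x).trans (R1.coe_toCpInt p x).symm)
  subst hJeq
  -- the two frames generate the same ideal of `𝒪_{ℂ_p}⟦T⟧` (width seat's concordance theorem)
  have hN' : (W.conductorNorm ℤ : ℕ) = N := by exact_mod_cast hN.symm
  have hpN : ¬ p ∣ N := by
    rw [← hN']
    exact not_dvd_conductorNorm_of_hasGoodReductionAtPrime W hgood
  have hpD : ¬ (p : ℤ) ∣ NumberField.discr K :=
    not_dvd_discr_of_ncard_primesOver hprime (by rw [hK.1]; exact hsplit)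
  have hconc : Ideal.span {PowerSeries.map (R1.unrToCpInt p) LW} =
      Ideal.span {PowerSeries.map (R1.unrToCpInt p) L} :=
    SignedBaseChangeAcDivFrameConcordance.span_map_eq_of_isCWBDPLFunction_of_isBDPLFunction hp2 hK hκ₂
      hγF.out hpN hpD hΩKw hΩK (coe_units_unrIntegers_ne_zero Ωpw) (coe_units_unrIntegers_ne_zero Ωp') hLW hL
  -- push the inclusion along `R₀ → 𝒪_{ℂ_p}`
  refine ⟨k, fun y hy ↦ ?_⟩
  have hmap := Ideal.map_mono (f := PowerSeries.map (R1.unrToCpInt p)) hkle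
  rw [Ideal.map_mul, Ideal.map_span, Set.image_singleton, Ideal.map_span, Set.image_singleton, Ideal.map_map,
    ← R1.map_toCpInt_eq_comp, PowerSeries.map_C, map_pow, map_natCast, hconc] at hmap
  exact hmap (Ideal.mul_mem_mul (Ideal.mem_span_singleton_self _) hy)

end Summit.BirchSwinnertonDyer.BirchSwinnertonDyer.Theorems.SignedBaseChangeAcDivAdmdefRamifiedNS

end
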